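import Literature.AlgebraicGeometry.Frobenioids.Thm42SubAssemblyIGeneral
import Literature.AlgebraicGeometry.Frobenioids.Thm42iiGeneral
import Literature.AlgebraicGeometry.Frobenioids.Thm42AssemblyPerfectAsPrinted
import Literature.AlgebraicGeometry.Frobenioids.PerfectionSquareFSMFF2024
import Literature.AlgebraicGeometry.Frobenioids.EquivalenceFrobeniusQuasiIsotropicOfPreSteps
import Literature.AlgebraicGeometry.Frobenioids.EquivalencePreStepsQuasiIsotropicFSMFF2024
import Literature.AlgebraicGeometry.Frobenioids.PerfectionStandardTypes
import Literature.AlgebraicGeometry.Frobenioids.PerfectionIsotropic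
import Literature.AlgebraicGeometry.Frobenioids.PerfectionIsFrobenioid
import HarnessLib

/-!
# [FrdI] Theorem 4.2 (i)(ii)(iii) AS TYPED, for Frobenioids NOT of perfect type, MODULO ONLY "`Ψ`, `Ψ⁻¹`
# preserve pre-steps" (Thm. 3.4 (ii)) — no hypothesis on the base categories beyond print's standard type
# (Def. 3.1 (i)(d)); corollaries over the author's revised (2024) FSMFF bases

Mochizuki, *The geometry of Frobenioids I: the general theory*, Kyushu J. Math. **62** (2008) 293–400,
§4, Theorem 4.2 p. 77, proof pp. 78–81: "to prove the remainder of assertion (i) … and assertions (ii),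
(iii), clearly it suffices to do so after passing to the perfections of the `C_i` [cf. Theorem 3.4, (iii)];
thus … we may assume, without loss of generality, that the `C_i` are of perfect type [cf. also Proposition
5.5, (iii), below]" (p. 78 ll. 40–44) [cite: MochizukiFrdI2008, Thm. 4.2 p.77]; *Comments* (2024) (28) p. 3 —
the revised definition of "FSMFF type" [cite: MochizukiFrdIComments2024, (28) p.3].

PROOF-ONLY file (cell abc-iut, layer L1, node `FrdI:Thm4.2`; seat abc-iut-w4-d105). The tree closes the typed
`Thm42i` / `Thm42ii` / `Thm42iii` for general (not necessarily perfect) Frobenioids over bases of FSM-type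
(`FrdI.T42.thm42i_of_isOfFSMType_of_perfection`, `thm42ii_ofFunctor_of_isOfFSMType`, …; seats
abc-iut-w4-d090 / w5-d162 / L1-d9), and at PERFECT type from the printed hypotheses alone
(`PreFrobenioidData.setting_of_perfectType_asPrinted`, seat abc-iut-w4-d093). Here the base hypothesis is
replaced throughout by the single transport statement it serves to prove — "`Ψ` and `Ψ⁻¹` preserve pre-steps"
(Thm. 3.4 (ii), first clause) — exactly as print argues: every other transport of Thm. 3.4 (iii) follows from
it (seat abc-iut-L1-t11's `FrdI.OfPreSteps.*`, `EquivalenceFrobeniusQuasiIsotropicOfPreSteps.lean`; `Ψ^pf`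
exists: `isFrobeniusCompatible_of_preservesPreSteps`), and the setting of the proof AT THE PERFECTIONS `C_i^pf`
is obtained from the PRINTED hypotheses at perfect type (`setting_of_perfectType_asPrinted`) once `C_i^pf` is
known to be a Frobenioid (Prop. 3.2 (iii), `PreFrobenioid.Perfection.isFrobenioid`, seats abc-iut-L1-d1 / L1-d9)
of standard (Prop. 5.5 (iii), `FrdI.Prop55Sub.prop55iii_pf_standard_of_not_groupLike`, seats abc-iut-w5-d042 /
L1-d9), isotropic (`Perfection.isOfIsotropicType_perfection`) and non-group-like type — the recipe of seat
abc-iut-w4-d109's `Thm49AssemblyFSMFF2024.lean`, here for the `C_i` themselves (which `Thm42Setting` makes of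
isotropic type).

* `FrdI.T42.setting_perfection_asPrinted` — the `FrdI.T42.Setting` at `(C₁^pf, C₂^pf, Ψ^pf)` from `Thm42Setting`
  on the `C_i`, `Φ_i` perf-factorial and ANY Frobenius-compatibility witness `hΨ` of `Ψ` (no base hypothesis beyond standard type (d));
* `FrdI.T42.thm42i_ofFunctor_of_preservesPreSteps` / `thm42ii_…` / `thm42iii_…` / `thm42ii_iii_…` — the typed
  Thm. 4.2 (i), (ii), (iii) at the `C`-level modulo "`Ψ`, `Ψ⁻¹` preserve pre-steps";
* `FrdI.T42.thm42i_ofFunctor_of_isOfFSMFFType2024` / `thm42ii_…` / `thm42iii_…` / `thm42ii_iii_…` — the same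
  over bases of FSMFF-type in the author's revised (2024) sense (`FrdI.isPreStep_map_of_quasiIsotropic_of_isOfFSMFFType2024`,
  seat abc-iut-L1-t11) — new for NON-perfect `C_i` (the tree had the 2024 twins at perfect type only).

No new definitions; no statement of the paper is strengthened; nothing here bears on [IUTchIII] Cor. 3.12.
-/

namespace Literature.AlgebraicGeometry.Frobenioids

namespace FrdI.T42

open CategoryTheory Opposite PreFrobenioidData PreFrobenioid.Perfection

universe w v v' u u'

variable {D₁ : Type u} [Category.{v} D₁] {Φ₁ : D₁ᵒᵖ ⥤ CommMonCat.{w}} {C₁ : Type u'} [Category.{v'} C₁]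
  {D₂ : Type u} [Category.{v} D₂] {Φ₂ : D₂ᵒᵖ ⥤ CommMonCat.{w}} {C₂ : Type u'} [Category.{v'} C₂]
  {F₁ : C₁ ⥤ ElemFrobenioid Φ₁} {F₂ : C₂ ⥤ ElemFrobenioid Φ₂} (Ψ : C₁ ≌ C₂)

/-! ### The setting of the proof at the perfections, from the printed hypotheses -/

/-- **The setting of the proof of Thm. 4.2 at THE perfections `C₁^pf ⥲ C₂^pf`, from the PRINTED hypotheses on
the `C_i`** (`Thm42Setting`: standard and isotropic type, not of group-like type; `Φ_i` perf-factorial) and ANY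
witness `hΨ` that `Ψ` is compatible with arrows of Frobenius type (so that `Ψ^pf` is defined) — NO hypothesis
on the bases beyond print's standard type (Def. 3.1 (i)(d), FSMFF as printed): `C_i^pf` is a Frobenioid (Prop. 3.2 (iii)) of perfect, isotropic, standard (Prop. 5.5 (iii)) and
non-group-like type, whence `setting_of_perfectType_asPrinted` (Thm. 3.4 (ii) at perfect type over the 2008
FSMFF bases of standard type (d)). [cite: MochizukiFrdI2008, Thm. 4.2 (i) p.78] -/
theorem setting_perfection_asPrinted (hF₁ : PreFrobenioid.IsFrobenioid F₁) (hF₂ : PreFrobenioid.IsFrobenioid F₂)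
    (hpf₁ : Objectwise (fun M _ => IsPerfFactorial M) Φ₁) (hpf₂ : Objectwise (fun M _ => IsPerfFactorial M) Φ₂)
    (hT : Thm42Setting (ofFunctor Φ₁ F₁) (ofFunctor Φ₂ F₂))
    (hΨ : PreFrobenioid.IsFrobeniusCompatible F₁ F₂ Ψ.functor) :
    haveI := map_isEquivalence (hF₁ := hF₁) (hF₂ := hF₂) Ψ hΨ
    Setting (ops hF₁).toFunctor (ops hF₂).toFunctor (map (hF₁ := hF₁) (hF₂ := hF₂) hΨ).asEquivalence := by
  haveI := map_isEquivalence (hF₁ := hF₁) (hF₂ := hF₂) Ψ hΨ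
  obtain ⟨hi₁, hi₂, -, -, ⟨N₁, hN₁⟩, ⟨N₂, hN₂⟩⟩ := of_thm42Setting hT
  have hs₁ := hT.standard.1
  have hs₂ := hT.standard.2
  have hiso₁ := isFrobeniusIsotropic_of_isOfIsotropicType hF₁ hi₁
  have hiso₂ := isFrobeniusIsotropic_of_isOfIsotropicType hF₂ hi₂
  -- Prop. 3.2 (iii): the perfections are Frobenioids
  have hPf₁ := PreFrobenioid.Perfection.isFrobenioid hF₁ hiso₁
  have hPf₂ := PreFrobenioid.Perfection.isFrobenioid hF₂ hiso₂
  -- Prop. 5.5 (iii): of standard type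
  have hng₁ : ¬ PreFrobenioid.IsOfType (PreFrobenioid.IsGroupLikeObj F₁) := fun h => hN₁ (h N₁)
  have hng₂ : ¬ PreFrobenioid.IsOfType (PreFrobenioid.IsGroupLikeObj F₂) := fun h => hN₂ (h N₂)
  have hnorm₁ : PreFrobenioid.IsOfType (PreFrobenioid.IsFrobeniusNormalized F₁) :=
    fun X => hs₁.frobeniusNormalized.obj X
  have hnorm₂ : PreFrobenioid.IsOfType (PreFrobenioid.IsFrobeniusNormalized F₂) :=
    fun X => hs₂.frobeniusNormalized.obj X
  have hsP₁ := FrdI.Prop55Sub.prop55iii_pf_standard_of_not_groupLike hF₁ hPf₁ hng₁ hiso₁ hnorm₁ hs₁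
  have hsP₂ := FrdI.Prop55Sub.prop55iii_pf_standard_of_not_groupLike hF₂ hPf₂ hng₂ hiso₂ hnorm₂ hs₂
  -- `Thm42Setting` for the perfections: standard, isotropic, not group-like (the objects `(N_i, 1)`)
  have hT' : Thm42Setting (ops hF₁) (ops hF₂) :=
    ⟨⟨hsP₁, hsP₂⟩, ⟨isOfIsotropicType_perfection hF₁ hiso₁, isOfIsotropicType_perfection hF₂ hiso₂⟩,
      ⟨fun h => hN₁ ((isGroupLikeObj_ops_iff (hF := hF₁) _).1 (h.obj ((toPf hF₁).obj N₁))),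
        fun h => hN₂ ((isGroupLikeObj_ops_iff (hF := hF₂) _).1 (h.obj ((toPf hF₂).obj N₂)))⟩⟩
  exact setting_of_perfectType_asPrinted (map (hF₁ := hF₁) (hF₂ := hF₂) hΨ).asEquivalence hPf₁ hPf₂
    ((ofFunctor_isOfPerfectType (ops hF₁).toFunctor).1 (isOfPerfectType_perfection hF₁ hiso₁))
    ((ofFunctor_isOfPerfectType (ops hF₂).toFunctor).1 (isOfPerfectType_perfection hF₂ hiso₂))
    (fun X => PerfectionIsPerfFactorial_holds (hpf₁ X)) (fun X => PerfectionIsPerfFactorial_holds (hpf₂ X)) hT'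

/-! ### Theorem 4.2 (i) modulo "`Ψ`, `Ψ⁻¹` preserve pre-steps" -/

set_option backward.isDefEq.respectTransparency false in
/-- **Theorem 4.2 (i) AS TYPED (`PreFrobenioidData.Thm42i`), for Frobenioids `C_i → F_{Φ_i}` with `Φ_i`
perf-factorial with NO hypothesis on the bases beyond print's standard type (Def. 3.1 (i)(d)), MODULO "`Ψ` and `Ψ⁻¹` preserve
pre-steps"** (Thm. 3.4 (ii), first clause): under `Thm42Setting`, `Ψ` preserves the steps that are primary
pre-steps, Div-identity endomorphisms, Div-Frobenius-trivial objects and universally Div-Frobenius-trivial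
objects. Proof = print's (p. 78): Thm. 3.4 (iii) at the `C`-level from pre-step preservation (seat
abc-iut-L1-t11's `FrdI.OfPreSteps.isFrobeniusType_map_quasiIsotropic` / `degFr_map` /
`isPullbackMorphism_map_quasiIsotropic`), and "passing to the perfections" for primary pre-steps and
Div-identity endomorphisms (`setting_perfection_asPrinted`, rows T42-L07/L11, `perfectWLOG_of_equivalence`).
[cite: MochizukiFrdI2008, Thm. 4.2 (i) p.77] -/
theorem thm42i_ofFunctor_of_preservesPreSteps (hF₁ : PreFrobenioid.IsFrobenioid F₁)
    (hF₂ : PreFrobenioid.IsFrobenioid F₂)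
    (hpf₁ : Objectwise (fun M _ => IsPerfFactorial M) Φ₁) (hpf₂ : Objectwise (fun M _ => IsPerfFactorial M) Φ₂)
    (hpre : ∀ ⦃X Y : C₁⦄ (φ : X ⟶ Y), PreFrobenioid.IsPreStep F₁ φ → PreFrobenioid.IsPreStep F₂ (Ψ.functor.map φ))
    (hpre' : ∀ ⦃X Y : C₂⦄ (φ : X ⟶ Y), PreFrobenioid.IsPreStep F₂ φ → PreFrobenioid.IsPreStep F₁ (Ψ.inverse.map φ)) :
    (ofFunctor Φ₁ F₁).Thm42i (ofFunctor Φ₂ F₂) Ψ := by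
  intro hT
  obtain ⟨hi₁, hi₂, hnd₁, hnd₂, ⟨N₁, hN₁⟩, ⟨N₂, hN₂⟩⟩ := of_thm42Setting hT
  have hs₁ := hT.standard.1
  have hs₂ := hT.standard.2
  have hq₁ := hs₁.quasiIsotropic
  have hq₂ := hs₂.quasiIsotropic
  have hP₂ := hF₂.isPreFrobenioid
  have hpreI : ∀ ⦃A B : C₁⦄ ⦃φ : A ⟶ B⦄, PreFrobenioid.IsPreStep F₁ φ →
      PreFrobenioid.IsPreStep F₂ (Ψ.functor.map φ) := fun _ _ φ h => hpre φ h
  have hpreI' : ∀ ⦃A B : C₂⦄ ⦃φ : A ⟶ B⦄, PreFrobenioid.IsPreStep F₂ φ →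
      PreFrobenioid.IsPreStep F₁ (Ψ.inverse.map φ) := fun _ _ φ h => hpre' φ h
  -- Thm. 3.4 (iii) at the level of the `C_i`, from pre-step preservation
  have hfrob : ∀ ⦃X Y : C₁⦄ (φ : X ⟶ Y), PreFrobenioid.IsFrobeniusType F₁ φ →
      PreFrobenioid.IsFrobeniusType F₂ (Ψ.functor.map φ) := fun _ _ _ h =>
    FrdI.OfPreSteps.isFrobeniusType_map_quasiIsotropic hF₁ hF₂ hq₁ hq₂ hnd₁ hnd₂ Ψ hpreI hpreI' hN₁ hN₂ h
  have hdeg : ∀ ⦃X Y : C₁⦄ (φ : X ⟶ Y),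
      PreFrobenioid.degFr F₂ (Ψ.functor.map φ) = PreFrobenioid.degFr F₁ φ := fun _ _ φ =>
    FrdI.OfPreSteps.degFr_map hF₁ hF₂ hq₁ hq₂ hnd₁ hnd₂ Ψ hpreI hpreI' hN₁ hN₂ φ
  have hpb' : ∀ ⦃X Y : C₂⦄ (φ : X ⟶ Y), PreFrobenioid.IsPullbackMorphism F₂ φ →
      PreFrobenioid.IsPullbackMorphism F₁ (Ψ.inverse.map φ) := fun _ _ _ h =>
    FrdI.OfPreSteps.isPullbackMorphism_map_quasiIsotropic hF₂ hF₁ hq₂ hq₁ hnd₂ hnd₁ Ψ.symm hpreI' hpreI hN₂ hN₁ h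
  have hΨ : PreFrobenioid.IsFrobeniusCompatible F₁ F₂ Ψ.functor :=
    isFrobeniusCompatible_of_preservesPreSteps hF₁ hF₂ hq₁ hq₂ hs₁.nonDilating hs₂.nonDilating Ψ
      (fun _ _ φ h => hpre φ h) (fun _ _ φ h => hpre' φ h) ⟨N₁, hN₁⟩ ⟨N₂, hN₂⟩
  -- the setting for the perfections (no base hypothesis beyond standard type)
  haveI := map_isEquivalence (hF₁ := hF₁) (hF₂ := hF₂) Ψ hΨ
  have S := setting_perfection_asPrinted Ψ hF₁ hF₂ hpf₁ hpf₂ hT hΨ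
  have hndp₁ : IsNonDilatingOn (ops hF₁).monFunctor :=
    isNonDilatingOn_of_ofFunctor (F := (ops hF₁).toFunctor) (isNonDilatingOn_ops hF₁ hs₁.nonDilating)
  have hndp₂ : IsNonDilatingOn (ops hF₂).monFunctor :=
    isNonDilatingOn_of_ofFunctor (F := (ops hF₂).toFunctor) (isNonDilatingOn_ops hF₂ hs₂.nonDilating)
  -- rows T42-L07 / T42-L11 for `Ψ^pf`
  have hprim_pf : ∀ ⦃X Y : PreFrobenioid.Perfection hF₁⦄ (f : X ⟶ Y), (ops hF₁).IsPrimaryPreStep f →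
      (ops hF₂).IsPrimaryPreStep ((map (hF₁ := hF₁) (hF₂ := hF₂) hΨ).map f) :=
    fun _ _ _ h => S.isPrimaryPreStep_map h
  have hdiv_pf : ∀ ⦃X : PreFrobenioid.Perfection hF₁⦄ (f : X ⟶ X), (ops hF₁).IsDivIdentity f →
      (ops hF₂).IsDivIdentity ((map (hF₁ := hF₁) (hF₂ := hF₂) hΨ).map f) := by
    intro X f hf
    have hf' : PreFrobenioid.IsDivIdentity (ops hF₁).toFunctor f :=
      (ofFunctor_isDivIdentity (ops hF₁).toFunctor f).1 hf
    refine (ofFunctor_isDivIdentity (ops hF₂).toFunctor _).2 ?_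
    by_cases hX : PreFrobenioid.IsGroupLikeObj (ops hF₁).toFunctor X
    · exact PreFrobenioid.isDivIdentity_of_isGroupLikeObj (S.isGroupLikeObj_map hX) _
    · exact preservesDivIdentity_holds _ _ _ S hndp₁ hndp₂ (fun _ _ _ h => S.isPrimaryPreStep_map h)
        (fun _ _ _ h => S.isPrimaryPreStep_inverse_map h) X hX f hf'
  -- row T42-L03: transport down to the `C_i`
  obtain ⟨hP, hDI⟩ := perfectWLOG_of_equivalence hF₁ hF₂ Ψ hΨ
  have hprim := hP hprim_pf
  have hdivid := hDI hdiv_pf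
  refine ⟨fun X Y φ hφ => ⟨⟨hpre φ hφ.1.1, fun h => hφ.1.2
      (by haveI := h; exact Ψ.fullyFaithfulFunctor.isIso_of_isIso_map φ)⟩, hprim φ hφ.2⟩,
    fun A α hα => ?_, fun A hA => ?_, fun A hA => ?_⟩
  · -- Div-identity endomorphisms
    rw [ofFunctor_isDivIdentity F₁] at hα
    rw [ofFunctor_isDivIdentity F₂]
    exact hdivid α hα
  · -- Div-Frobenius-trivial objects
    rw [ofFunctor_isDivFrobeniusTrivial F₁] at hA
    rw [ofFunctor_isDivFrobeniusTrivial F₂]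
    exact PreFrobenioid.isDivFrobeniusTrivial_map Ψ hfrob hdeg (fun α h => hdivid α h) hA
  · -- universally Div-Frobenius-trivial objects
    have hA' : PreFrobenioid.IsUniversallyDivFrobeniusTrivial F₁ A := fun A' φ hφ =>
      (ofFunctor_isDivFrobeniusTrivial F₁ A').1 (hA φ ((ofFunctor_isPullbackMorphism F₁ φ).2 hφ))
    intro A₂ ψ hψ
    rw [ofFunctor_isDivFrobeniusTrivial F₂]
    exact PreFrobenioid.isUniversallyDivFrobeniusTrivial_map Ψ hP₂ hfrob hdeg hpb' (fun _ _ _ α h => hdivid α h)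
      hA' ψ ((ofFunctor_isPullbackMorphism F₂ ψ).1 hψ)

/-! ### Theorem 4.2 (ii), (iii) modulo "`Ψ`, `Ψ⁻¹` preserve pre-steps" -/

/-- **Theorem 4.2 (ii) AS TYPED (`PreFrobenioidData.Thm42ii`), for Frobenioids with `Φ_i` perf-factorial with
no base hypothesis beyond print's standard type, MODULO "`Ψ` and `Ψ⁻¹` preserve pre-steps"**: under `Thm42Setting` there is a UNIQUE family of
bijections `Ψ^Prime_A : Prime(Φ₁(A)) ≃ Prime(Φ₂(Ψ A))` with clauses (a) and (b). Steps from pre-steps (`Ψ`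
reflects isomorphisms); primary pre-steps along `Ψ` and `Ψ⁻¹` by Thm. 4.2 (i) through the perfections
(`thm42i_ofFunctor_of_preservesPreSteps` for `Ψ` and `Ψ.symm`); then seat abc-iut-w5-d162's
`PreFrobenioid.existsUnique_primesEquiv_family'`. [cite: MochizukiFrdI2008, Thm. 4.2 (ii) p.77] -/
theorem thm42ii_ofFunctor_of_preservesPreSteps (hF₁ : PreFrobenioid.IsFrobenioid F₁)
    (hF₂ : PreFrobenioid.IsFrobenioid F₂)
    (hpf₁ : Objectwise (fun M _ => IsPerfFactorial M) Φ₁) (hpf₂ : Objectwise (fun M _ => IsPerfFactorial M) Φ₂)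
    (hpre : ∀ ⦃X Y : C₁⦄ (φ : X ⟶ Y), PreFrobenioid.IsPreStep F₁ φ → PreFrobenioid.IsPreStep F₂ (Ψ.functor.map φ))
    (hpre' : ∀ ⦃X Y : C₂⦄ (φ : X ⟶ Y), PreFrobenioid.IsPreStep F₂ φ → PreFrobenioid.IsPreStep F₁ (Ψ.inverse.map φ)) :
    (ofFunctor Φ₁ F₁).Thm42ii (ofFunctor Φ₂ F₂) Ψ := by
  intro hT
  have hP₁ := hF₁.isPreFrobenioid
  have hP₂ := hF₂.isPreFrobenioid
  obtain ⟨hi₁, hi₂, -, -, -, -⟩ := of_thm42Setting hT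
  -- Thm. 4.2 (i) for `Ψ` and for `Ψ⁻¹`: primary pre-steps
  obtain ⟨h₁, -, -, -⟩ := thm42i_ofFunctor_of_preservesPreSteps Ψ hF₁ hF₂ hpf₁ hpf₂ hpre hpre' hT
  obtain ⟨h₁', -, -, -⟩ := thm42i_ofFunctor_of_preservesPreSteps Ψ.symm hF₂ hF₁ hpf₂ hpf₁
    (fun _ _ φ h => hpre' φ h) (fun _ _ φ h => hpre φ h) (thm42Setting_symm hT)
  have hprim : ∀ ⦃X Y : C₁⦄ (φ : X ⟶ Y), PreFrobenioid.IsPrimaryPreStep F₁ φ →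
      PreFrobenioid.IsPrimaryPreStep F₂ (Ψ.functor.map φ) := fun _ _ φ hφ => (h₁ φ ⟨hφ.isStep hP₁, hφ⟩).2
  have hprim' : ∀ ⦃X Y : C₂⦄ (φ : X ⟶ Y), PreFrobenioid.IsPrimaryPreStep F₂ φ →
      PreFrobenioid.IsPrimaryPreStep F₁ (Ψ.inverse.map φ) := fun _ _ φ hφ => (h₁' φ ⟨hφ.isStep hP₂, hφ⟩).2
  obtain ⟨e, he, hu⟩ := PreFrobenioid.existsUnique_primesEquiv_family' Ψ hF₁ hF₂ hi₁ hi₂ hpf₁ hpf₂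
    (fun _ _ φ hφ => ⟨hpre φ hφ.1, fun h => hφ.2
      (by haveI := h; exact Ψ.fullyFaithfulFunctor.isIso_of_isIso_map φ)⟩)
    hpre hpre' hprim hprim'
  refine ⟨e, fun A 𝔭 => ⟨fun B φ hφ => (he A 𝔭).1 φ ((ofFunctor_isCoAngularPreStep F₁ φ).mp hφ),
    fun B ψ hψ => (he A 𝔭).2 ψ ((ofFunctor_isCoAngularPreStep F₁ ψ).mp hψ)⟩, fun e' he' => hu e' ?_⟩
  intro A 𝔭
  exact ⟨fun B φ hφ => (he' A 𝔭).1 φ ((ofFunctor_isCoAngularPreStep F₁ φ).mpr hφ),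
    fun B ψ hψ => (he' A 𝔭).2 ψ ((ofFunctor_isCoAngularPreStep F₁ ψ).mpr hψ)⟩

/-- **Theorem 4.2 (iii) AS TYPED (`PreFrobenioidData.Thm42iii`), for Frobenioids with `Φ_i` perf-factorial with
no base hypothesis beyond print's standard type, MODULO "`Ψ` and `Ψ⁻¹` preserve pre-steps"**, for every family `e` with the clauses of (ii):
the right-hand and left-hand isomorphisms `Φ₁(A)_𝔭 ⥲ Φ₂(Ψ A)_{e 𝔭}` at Div-Frobenius-trivial `A` (seat
abc-iut-L1-t14's `thm42iii_of`; Frobenius type / degrees by `FrdI.OfPreSteps`, Div-identity endomorphisms by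
Thm. 4.2 (i) through the perfections). [cite: MochizukiFrdI2008, Thm. 4.2 (iii) p.78] -/
theorem thm42iii_ofFunctor_of_preservesPreSteps (hF₁ : PreFrobenioid.IsFrobenioid F₁)
    (hF₂ : PreFrobenioid.IsFrobenioid F₂)
    (hpf₁ : Objectwise (fun M _ => IsPerfFactorial M) Φ₁) (hpf₂ : Objectwise (fun M _ => IsPerfFactorial M) Φ₂)
    (hpre : ∀ ⦃X Y : C₁⦄ (φ : X ⟶ Y), PreFrobenioid.IsPreStep F₁ φ → PreFrobenioid.IsPreStep F₂ (Ψ.functor.map φ))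
    (hpre' : ∀ ⦃X Y : C₂⦄ (φ : X ⟶ Y), PreFrobenioid.IsPreStep F₂ φ → PreFrobenioid.IsPreStep F₁ (Ψ.inverse.map φ))
    (e : ∀ A : C₁, Primes (Φ₁.obj (op (PreFrobenioid.baseObj F₁ A))) ≃
      Primes (Φ₂.obj (op (PreFrobenioid.baseObj F₂ (Ψ.functor.obj A)))))
    (he : ∀ (A : C₁) (𝔭 : Primes (Φ₁.obj (op (PreFrobenioid.baseObj F₁ A)))),
      (∀ ⦃B : C₁⦄ (φ : A ⟶ B), PreFrobenioid.IsCoAngularPreStep F₁ φ →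
          (PreFrobenioid.Div F₁ φ ∈ 𝔭.submonoid ↔
            PreFrobenioid.Div F₂ (Ψ.functor.map φ) ∈ (e A 𝔭).submonoid)) ∧
        ∀ ⦃B : C₁⦄ (ψ : B ⟶ A), PreFrobenioid.IsCoAngularPreStep F₁ ψ →
          ((∃ y ∈ 𝔭.submonoid, Frobenioids.pull Φ₁ (PreFrobenioid.Base F₁ ψ) y = PreFrobenioid.Div F₁ ψ) ↔
            ∃ y ∈ (e A 𝔭).submonoid, Frobenioids.pull Φ₂ (PreFrobenioid.Base F₂ (Ψ.functor.map ψ)) y =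
              PreFrobenioid.Div F₂ (Ψ.functor.map ψ))) :
    (ofFunctor Φ₁ F₁).Thm42iii (ofFunctor Φ₂ F₂) Ψ e := by
  intro hT
  obtain ⟨-, -, hnd₁, hnd₂, ⟨N₁, hN₁⟩, ⟨N₂, hN₂⟩⟩ := of_thm42Setting hT
  have hq₁ := hT.standard.1.quasiIsotropic
  have hq₂ := hT.standard.2.quasiIsotropic
  have hpreI : ∀ ⦃A B : C₁⦄ ⦃φ : A ⟶ B⦄, PreFrobenioid.IsPreStep F₁ φ →
      PreFrobenioid.IsPreStep F₂ (Ψ.functor.map φ) := fun _ _ φ h => hpre φ h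
  have hpreI' : ∀ ⦃A B : C₂⦄ ⦃φ : A ⟶ B⦄, PreFrobenioid.IsPreStep F₂ φ →
      PreFrobenioid.IsPreStep F₁ (Ψ.inverse.map φ) := fun _ _ φ h => hpre' φ h
  obtain ⟨-, hdiv, -, -⟩ := thm42i_ofFunctor_of_preservesPreSteps Ψ hF₁ hF₂ hpf₁ hpf₂ hpre hpre' hT
  exact thm42iii_of Ψ hF₁ hF₂ hpf₁ hpf₂ hpre hpre'
    (fun _ _ _ h => FrdI.OfPreSteps.isFrobeniusType_map_quasiIsotropic hF₁ hF₂ hq₁ hq₂ hnd₁ hnd₂ Ψ hpreI hpreI'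
      hN₁ hN₂ h)
    (fun _ _ φ => FrdI.OfPreSteps.degFr_map hF₁ hF₂ hq₁ hq₂ hnd₁ hnd₂ Ψ hpreI hpreI' hN₁ hN₂ φ)
    (fun A α hα => (ofFunctor_isDivIdentity F₂ _).1 (hdiv A α ((ofFunctor_isDivIdentity F₁ α).2 hα))) e he hT

/-- **Theorem 4.2 (ii) and (iii) together, modulo "`Ψ`, `Ψ⁻¹` preserve pre-steps"**: THE family of prime
bijections of (ii) exists (clauses (a), (b)) and (iii) holds for it. [cite: MochizukiFrdI2008, Thm. 4.2 (iii) p.78] -/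
theorem thm42ii_iii_ofFunctor_of_preservesPreSteps (hF₁ : PreFrobenioid.IsFrobenioid F₁)
    (hF₂ : PreFrobenioid.IsFrobenioid F₂)
    (hpf₁ : Objectwise (fun M _ => IsPerfFactorial M) Φ₁) (hpf₂ : Objectwise (fun M _ => IsPerfFactorial M) Φ₂)
    (hpre : ∀ ⦃X Y : C₁⦄ (φ : X ⟶ Y), PreFrobenioid.IsPreStep F₁ φ → PreFrobenioid.IsPreStep F₂ (Ψ.functor.map φ))
    (hpre' : ∀ ⦃X Y : C₂⦄ (φ : X ⟶ Y), PreFrobenioid.IsPreStep F₂ φ → PreFrobenioid.IsPreStep F₁ (Ψ.inverse.map φ))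
    (hT : Thm42Setting (ofFunctor Φ₁ F₁) (ofFunctor Φ₂ F₂)) :
    ∃ e : ∀ A : C₁, Primes (Φ₁.obj (op (PreFrobenioid.baseObj F₁ A))) ≃
        Primes (Φ₂.obj (op (PreFrobenioid.baseObj F₂ (Ψ.functor.obj A)))),
      (∀ (A : C₁) (𝔭 : Primes (Φ₁.obj (op (PreFrobenioid.baseObj F₁ A)))),
        (∀ ⦃B : C₁⦄ (φ : A ⟶ B), PreFrobenioid.IsCoAngularPreStep F₁ φ →
            (PreFrobenioid.Div F₁ φ ∈ 𝔭.submonoid ↔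
              PreFrobenioid.Div F₂ (Ψ.functor.map φ) ∈ (e A 𝔭).submonoid)) ∧
          ∀ ⦃B : C₁⦄ (ψ : B ⟶ A), PreFrobenioid.IsCoAngularPreStep F₁ ψ →
            ((∃ y ∈ 𝔭.submonoid, Frobenioids.pull Φ₁ (PreFrobenioid.Base F₁ ψ) y = PreFrobenioid.Div F₁ ψ) ↔
              ∃ y ∈ (e A 𝔭).submonoid, Frobenioids.pull Φ₂ (PreFrobenioid.Base F₂ (Ψ.functor.map ψ)) y =
                PreFrobenioid.Div F₂ (Ψ.functor.map ψ))) ∧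
      (ofFunctor Φ₁ F₁).Thm42iii (ofFunctor Φ₂ F₂) Ψ e := by
  obtain ⟨e, he, -⟩ := thm42ii_ofFunctor_of_preservesPreSteps Ψ hF₁ hF₂ hpf₁ hpf₂ hpre hpre' hT
  have he' : ∀ (A : C₁) (𝔭 : Primes (Φ₁.obj (op (PreFrobenioid.baseObj F₁ A)))),
      (∀ ⦃B : C₁⦄ (φ : A ⟶ B), PreFrobenioid.IsCoAngularPreStep F₁ φ →
          (PreFrobenioid.Div F₁ φ ∈ 𝔭.submonoid ↔
            PreFrobenioid.Div F₂ (Ψ.functor.map φ) ∈ (e A 𝔭).submonoid)) ∧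
        ∀ ⦃B : C₁⦄ (ψ : B ⟶ A), PreFrobenioid.IsCoAngularPreStep F₁ ψ →
          ((∃ y ∈ 𝔭.submonoid, Frobenioids.pull Φ₁ (PreFrobenioid.Base F₁ ψ) y = PreFrobenioid.Div F₁ ψ) ↔
            ∃ y ∈ (e A 𝔭).submonoid, Frobenioids.pull Φ₂ (PreFrobenioid.Base F₂ (Ψ.functor.map ψ)) y =
              PreFrobenioid.Div F₂ (Ψ.functor.map ψ)) := fun A 𝔭 =>
    ⟨fun B φ hφ => (he A 𝔭).1 φ ((ofFunctor_isCoAngularPreStep F₁ φ).mpr hφ),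
      fun B ψ hψ => (he A 𝔭).2 ψ ((ofFunctor_isCoAngularPreStep F₁ ψ).mpr hψ)⟩
  exact ⟨e, he', thm42iii_ofFunctor_of_preservesPreSteps Ψ hF₁ hF₂ hpf₁ hpf₂ hpre hpre' e he'⟩

/-! ### Corollaries over the author's revised (2024) FSMFF bases -/

/-- **Theorem 4.2 (i) AS TYPED over FSMFF-type bases in the author's revised (2024) sense**, for Frobenioids NOT
assumed of perfect type (Thm. 3.4 (ii) over such bases: `FrdI.isPreStep_map_of_quasiIsotropic_of_isOfFSMFFType2024`,
seat abc-iut-L1-t11). [cite: MochizukiFrdI2008, Thm. 4.2 (i) p.77] [cite: MochizukiFrdIComments2024, (28) p.3] -/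
theorem thm42i_ofFunctor_of_isOfFSMFFType2024 (hF₁ : PreFrobenioid.IsFrobenioid F₁)
    (hF₂ : PreFrobenioid.IsFrobenioid F₂)
    (hpf₁ : Objectwise (fun M _ => IsPerfFactorial M) Φ₁) (hpf₂ : Objectwise (fun M _ => IsPerfFactorial M) Φ₂)
    (hD₁ : IsOfFSMFFType2024 D₁) (hD₂ : IsOfFSMFFType2024 D₂) :
    (ofFunctor Φ₁ F₁).Thm42i (ofFunctor Φ₂ F₂) Ψ := fun hT =>
  thm42i_ofFunctor_of_preservesPreSteps Ψ hF₁ hF₂ hpf₁ hpf₂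
    (fun _ _ _ h => FrdI.isPreStep_map_of_quasiIsotropic_of_isOfFSMFFType2024 hF₁ hF₂
      hT.standard.1.quasiIsotropic hT.standard.2.quasiIsotropic hD₁ hD₂ Ψ h)
    (fun _ _ _ h => FrdI.isPreStep_map_of_quasiIsotropic_of_isOfFSMFFType2024 hF₂ hF₁
      hT.standard.2.quasiIsotropic hT.standard.1.quasiIsotropic hD₂ hD₁ Ψ.symm h) hT

/-- **Theorem 4.2 (ii) AS TYPED over FSMFF-type bases in the author's revised (2024) sense**, for Frobenioids NOT
assumed of perfect type. [cite: MochizukiFrdI2008, Thm. 4.2 (ii) p.77] [cite: MochizukiFrdIComments2024, (28) p.3] -/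
theorem thm42ii_ofFunctor_of_isOfFSMFFType2024 (hF₁ : PreFrobenioid.IsFrobenioid F₁)
    (hF₂ : PreFrobenioid.IsFrobenioid F₂)
    (hpf₁ : Objectwise (fun M _ => IsPerfFactorial M) Φ₁) (hpf₂ : Objectwise (fun M _ => IsPerfFactorial M) Φ₂)
    (hD₁ : IsOfFSMFFType2024 D₁) (hD₂ : IsOfFSMFFType2024 D₂) :
    (ofFunctor Φ₁ F₁).Thm42ii (ofFunctor Φ₂ F₂) Ψ := fun hT =>
  thm42ii_ofFunctor_of_preservesPreSteps Ψ hF₁ hF₂ hpf₁ hpf₂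
    (fun _ _ _ h => FrdI.isPreStep_map_of_quasiIsotropic_of_isOfFSMFFType2024 hF₁ hF₂
      hT.standard.1.quasiIsotropic hT.standard.2.quasiIsotropic hD₁ hD₂ Ψ h)
    (fun _ _ _ h => FrdI.isPreStep_map_of_quasiIsotropic_of_isOfFSMFFType2024 hF₂ hF₁
      hT.standard.2.quasiIsotropic hT.standard.1.quasiIsotropic hD₂ hD₁ Ψ.symm h) hT

/-- **Theorem 4.2 (iii) AS TYPED over FSMFF-type bases in the author's revised (2024) sense**, for Frobenioids NOT
assumed of perfect type, for every family `e` with the clauses of (ii).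
[cite: MochizukiFrdI2008, Thm. 4.2 (iii) p.78] [cite: MochizukiFrdIComments2024, (28) p.3] -/
theorem thm42iii_ofFunctor_of_isOfFSMFFType2024 (hF₁ : PreFrobenioid.IsFrobenioid F₁)
    (hF₂ : PreFrobenioid.IsFrobenioid F₂)
    (hpf₁ : Objectwise (fun M _ => IsPerfFactorial M) Φ₁) (hpf₂ : Objectwise (fun M _ => IsPerfFactorial M) Φ₂)
    (hD₁ : IsOfFSMFFType2024 D₁) (hD₂ : IsOfFSMFFType2024 D₂)
    (e : ∀ A : C₁, Primes (Φ₁.obj (op (PreFrobenioid.baseObj F₁ A))) ≃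
      Primes (Φ₂.obj (op (PreFrobenioid.baseObj F₂ (Ψ.functor.obj A)))))
    (he : ∀ (A : C₁) (𝔭 : Primes (Φ₁.obj (op (PreFrobenioid.baseObj F₁ A)))),
      (∀ ⦃B : C₁⦄ (φ : A ⟶ B), PreFrobenioid.IsCoAngularPreStep F₁ φ →
          (PreFrobenioid.Div F₁ φ ∈ 𝔭.submonoid ↔
            PreFrobenioid.Div F₂ (Ψ.functor.map φ) ∈ (e A 𝔭).submonoid)) ∧
        ∀ ⦃B : C₁⦄ (ψ : B ⟶ A), PreFrobenioid.IsCoAngularPreStep F₁ ψ →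
          ((∃ y ∈ 𝔭.submonoid, Frobenioids.pull Φ₁ (PreFrobenioid.Base F₁ ψ) y = PreFrobenioid.Div F₁ ψ) ↔
            ∃ y ∈ (e A 𝔭).submonoid, Frobenioids.pull Φ₂ (PreFrobenioid.Base F₂ (Ψ.functor.map ψ)) y =
              PreFrobenioid.Div F₂ (Ψ.functor.map ψ))) :
    (ofFunctor Φ₁ F₁).Thm42iii (ofFunctor Φ₂ F₂) Ψ e := fun hT =>
  thm42iii_ofFunctor_of_preservesPreSteps Ψ hF₁ hF₂ hpf₁ hpf₂
    (fun _ _ _ h => FrdI.isPreStep_map_of_quasiIsotropic_of_isOfFSMFFType2024 hF₁ hF₂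
      hT.standard.1.quasiIsotropic hT.standard.2.quasiIsotropic hD₁ hD₂ Ψ h)
    (fun _ _ _ h => FrdI.isPreStep_map_of_quasiIsotropic_of_isOfFSMFFType2024 hF₂ hF₁
      hT.standard.2.quasiIsotropic hT.standard.1.quasiIsotropic hD₂ hD₁ Ψ.symm h) e he hT

/-- **Theorem 4.2 (ii) and (iii) together over FSMFF-type bases in the author's revised (2024) sense**, for
Frobenioids NOT assumed of perfect type. [cite: MochizukiFrdI2008, Thm. 4.2 (iii) p.78]
[cite: MochizukiFrdIComments2024, (28) p.3] -/
theorem thm42ii_iii_ofFunctor_of_isOfFSMFFType2024 (hF₁ : PreFrobenioid.IsFrobenioid F₁)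
    (hF₂ : PreFrobenioid.IsFrobenioid F₂)
    (hpf₁ : Objectwise (fun M _ => IsPerfFactorial M) Φ₁) (hpf₂ : Objectwise (fun M _ => IsPerfFactorial M) Φ₂)
    (hD₁ : IsOfFSMFFType2024 D₁) (hD₂ : IsOfFSMFFType2024 D₂)
    (hT : Thm42Setting (ofFunctor Φ₁ F₁) (ofFunctor Φ₂ F₂)) :
    ∃ e : ∀ A : C₁, Primes (Φ₁.obj (op (PreFrobenioid.baseObj F₁ A))) ≃
        Primes (Φ₂.obj (op (PreFrobenioid.baseObj F₂ (Ψ.functor.obj A)))),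
      (∀ (A : C₁) (𝔭 : Primes (Φ₁.obj (op (PreFrobenioid.baseObj F₁ A)))),
        (∀ ⦃B : C₁⦄ (φ : A ⟶ B), PreFrobenioid.IsCoAngularPreStep F₁ φ →
            (PreFrobenioid.Div F₁ φ ∈ 𝔭.submonoid ↔
              PreFrobenioid.Div F₂ (Ψ.functor.map φ) ∈ (e A 𝔭).submonoid)) ∧
          ∀ ⦃B : C₁⦄ (ψ : B ⟶ A), PreFrobenioid.IsCoAngularPreStep F₁ ψ →
            ((∃ y ∈ 𝔭.submonoid, Frobenioids.pull Φ₁ (PreFrobenioid.Base F₁ ψ) y = PreFrobenioid.Div F₁ ψ) ↔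
              ∃ y ∈ (e A 𝔭).submonoid, Frobenioids.pull Φ₂ (PreFrobenioid.Base F₂ (Ψ.functor.map ψ)) y =
                PreFrobenioid.Div F₂ (Ψ.functor.map ψ))) ∧
      (ofFunctor Φ₁ F₁).Thm42iii (ofFunctor Φ₂ F₂) Ψ e :=
  thm42ii_iii_ofFunctor_of_preservesPreSteps Ψ hF₁ hF₂ hpf₁ hpf₂
    (fun _ _ _ h => FrdI.isPreStep_map_of_quasiIsotropic_of_isOfFSMFFType2024 hF₁ hF₂
      hT.standard.1.quasiIsotropic hT.standard.2.quasiIsotropic hD₁ hD₂ Ψ h)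
    (fun _ _ _ h => FrdI.isPreStep_map_of_quasiIsotropic_of_isOfFSMFFType2024 hF₂ hF₁
      hT.standard.2.quasiIsotropic hT.standard.1.quasiIsotropic hD₂ hD₁ Ψ.symm h) hT

end FrdI.T42

end Literature.AlgebraicGeometry.Frobenioids
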